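import Mathlib.Analysis.Complex.Polynomial.Basic
import Mathlib.Analysis.InnerProductSpace.Projection.FiniteDimensional
import Mathlib.Analysis.InnerProductSpace.Trace
import Mathlib.LinearAlgebra.Eigenspace.Zero

/-!
# Trace count on a spectral subspace (support for stub `stub_kyFanCount`)
(line `covariant-laplacian-floor`, crux `Summit.QuantumFields.QCD.Theses.SpectralDefectExtinction.TipPricing`,
item stmt-QuantumFields-8967; registered sub-goal `stub_kyFanTraceCount`)

Finite-dimensional linear algebra over `ℂ`, Mathlib only.  For an endomorphism `f` of a
finite-dimensional complex inner product space `E` and a set of complex numbers `p`: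

* `kyFan_roots_charpoly_restrict` — on the `f`-invariant spectral subspace
  `V = ⨆_{p z} maxGenEigenspace f z` the characteristic polynomial of `f|_V` has as roots exactly the
  roots `z` of `χ_f` with `p z`, with multiplicity (generalized eigenspaces of a restriction,
  `Submodule.inf_genEigenspace`; `dim maxGenEigenspace = algebraic multiplicity`,
  `LinearMap.finrank_maxGenEigenspace_eq`; independence of generalized eigenspaces); hence
  `dim V = #{roots z : p z}` (`kyFan_finrank_biSup`) and `tr f|_V = Σ_{p z} z` (`kyFan_trace_restrict`).
* `kyFan_re_trace_restrict_ge` — **trace floor**: if `Re⟪x, f x⟫ ≥ 0` on `E` and `≥ c‖x‖²` on a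
  subspace `K`, then `Re tr f|_V ≥ c · dim (V ∩ K)` (the trace in an orthonormal basis of `V`
  collected from orthonormal bases of `V ∩ K` and of its orthogonal complement in `V`,
  `LinearMap.trace_eq_sum_inner`, `DirectSum.IsInternal.collectedOrthonormalBasis`).
* `stub_kyFanTraceCount` — the registered packaging of the two, consumed by `stub_kyFanCount`
  (Ky Fan's count of eigenvalues of a non-normal matrix with small real part by the low levels of
  its positive Hermitian part).

Reference for the mathematics: Ky Fan, Proc. NAS 36 (1950) 31–35; R. Bhatia, *Matrix Analysis*
(1997), Prop. III.5.3 (`Re λ(A) ≺ λ(Re A)`), here in the weak counting form that avoids a Schur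
triangularization.
-/

namespace Summit.QuantumFields.QCD.Cruxes.TipPricing.CovariantLaplacianFloor

open scoped InnerProductSpace

noncomputable section

/-! ## Roots of the characteristic polynomial of a spectral restriction -/

section SpectralRestriction

variable {E : Type*} [AddCommGroup E] [Module ℂ E]

/-- A sup of maximal generalized eigenspaces of `f` is `f`-invariant. -/
theorem kyFan_mapsTo_biSup (f : Module.End ℂ E) (p : ℂ → Prop) :
    ∀ x ∈ ⨆ (z : ℂ) (_ : p z), f.maxGenEigenspace z,
      f x ∈ ⨆ (z : ℂ) (_ : p z), f.maxGenEigenspace z := by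
  intro x hx
  have h : (⨆ (z : ℂ) (_ : p z), f.maxGenEigenspace z) ≤
      (⨆ (z : ℂ) (_ : p z), f.maxGenEigenspace z).comap f := by
    refine iSup₂_le fun z hz y hy => ?_
    exact Submodule.mem_comap.mpr (Submodule.mem_iSup_of_mem z (Submodule.mem_iSup_of_mem hz
      (Module.End.mapsTo_maxGenEigenspace_of_comm (Commute.refl f) z hy)))
  exact h hx

variable [FiniteDimensional ℂ E]

/-- **Roots of the restriction to a spectral subspace.**  If `V = ⨆_{p z} maxGenEigenspace f z`,
the roots of the characteristic polynomial of `f|_V` are the roots `z` of that of `f` with `p z`,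
with the same multiplicities: the generalized eigenspaces of `f|_V` are `V ∩` those of `f`
(`Submodule.inf_genEigenspace`), their dimensions are the algebraic multiplicities
(`LinearMap.finrank_maxGenEigenspace_eq`), and `V ∩ maxGenEigenspace f z = 0` for `¬ p z` by
independence of the generalized eigenspaces. -/
theorem kyFan_roots_charpoly_restrict (f : Module.End ℂ E) (p : ℂ → Prop) [DecidablePred p]
    (hV : ∀ x ∈ ⨆ (z : ℂ) (_ : p z), f.maxGenEigenspace z,
      f x ∈ ⨆ (z : ℂ) (_ : p z), f.maxGenEigenspace z) :
    (f.restrict hV).charpoly.roots = f.charpoly.roots.filter p := by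
  set V := ⨆ (z : ℂ) (_ : p z), f.maxGenEigenspace z with hVdef
  refine Multiset.ext.mpr fun z => ?_
  rw [Polynomial.count_roots, ← LinearMap.finrank_maxGenEigenspace_eq,
    ← Submodule.finrank_map_subtype_eq V, ← Submodule.inf_genEigenspace f V hV]
  by_cases hz : p z
  · rw [Multiset.count_filter_of_pos hz, Polynomial.count_roots,
      ← LinearMap.finrank_maxGenEigenspace_eq,
      inf_eq_right.mpr (show f.maxGenEigenspace z ≤ V from le_iSup₂_of_le z hz le_rfl)]
  · have hbot : V ⊓ f.maxGenEigenspace z = ⊥ :=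
      (f.independent_maxGenEigenspace.disjoint_biSup (y := {w | p w}) hz).symm.eq_bot
    rw [Multiset.count_filter_of_neg hz, hbot, finrank_bot]

/-- Dimension of the spectral subspace `⨆_{p z} maxGenEigenspace f z`: the number of roots `z` of the
characteristic polynomial of `f` (with multiplicity) with `p z`. -/
theorem kyFan_finrank_biSup (f : Module.End ℂ E) (p : ℂ → Prop) [DecidablePred p]
    (hV : ∀ x ∈ ⨆ (z : ℂ) (_ : p z), f.maxGenEigenspace z,
      f x ∈ ⨆ (z : ℂ) (_ : p z), f.maxGenEigenspace z) :
    Module.finrank ℂ ↥(⨆ (z : ℂ) (_ : p z), f.maxGenEigenspace z) =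
      Multiset.card (f.charpoly.roots.filter p) := by
  rw [← kyFan_roots_charpoly_restrict f p hV, ← (IsAlgClosed.splits _).natDegree_eq_card_roots,
    LinearMap.charpoly_natDegree]

/-- Trace of `f` on the spectral subspace `⨆_{p z} maxGenEigenspace f z`: the sum of the roots `z`
of the characteristic polynomial of `f` (with multiplicity) with `p z`. -/
theorem kyFan_trace_restrict (f : Module.End ℂ E) (p : ℂ → Prop) [DecidablePred p]
    (hV : ∀ x ∈ ⨆ (z : ℂ) (_ : p z), f.maxGenEigenspace z,
      f x ∈ ⨆ (z : ℂ) (_ : p z), f.maxGenEigenspace z) :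
    LinearMap.trace ℂ _ (f.restrict hV) = (f.charpoly.roots.filter p).sum := by
  rw [Module.End.trace_eq_sum_roots_charpoly_of_splits (IsAlgClosed.splits _),
    kyFan_roots_charpoly_restrict f p hV]

end SpectralRestriction

/-! ## The trace of a restriction in an adapted orthonormal basis -/

section Trace

variable {E : Type*} [NormedAddCommGroup E] [InnerProductSpace ℂ E] [FiniteDimensional ℂ E]

/-- **Trace floor.**  Let `V` be `f`-invariant.  If `Re⟪x, f x⟫ ≥ 0` everywhere and
`Re⟪x, f x⟫ ≥ c‖x‖²` on the subspace `K`, then `Re tr(f|_V) ≥ c · dim(V ∩ K)`: compute the trace in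
an orthonormal basis of `V` collected from orthonormal bases of `V ∩ K` and of its orthogonal
complement inside `V`. -/
theorem kyFan_re_trace_restrict_ge (f : Module.End ℂ E) (V K : Submodule ℂ E)
    (hV : ∀ x ∈ V, f x ∈ V) {c : ℝ} (h0 : ∀ x : E, 0 ≤ (⟪x, f x⟫_ℂ).re)
    (hK : ∀ x ∈ K, c * ‖x‖ ^ 2 ≤ (⟪x, f x⟫_ℂ).re) :
    c * (Module.finrank ℂ ↥(V ⊓ K) : ℝ) ≤ (LinearMap.trace ℂ V (f.restrict hV)).re := by
  -- `V ∩ K` as a subspace `K'` of the inner product space `V`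
  let K' : Submodule ℂ V := (V ⊓ K).comap V.subtype
  have hK'dim : Module.finrank ℂ K' = Module.finrank ℂ ↥(V ⊓ K) :=
    (Submodule.comapSubtypeEquivOfLe inf_le_left).finrank_eq
  rw [← hK'dim]
  -- the orthogonal decomposition `V = K' ⊕ K'ᗮ` and a collected orthonormal basis
  let A : Bool → Submodule ℂ V := fun b => cond b K' K'ᗮ
  have hOF : OrthogonalFamily ℂ (fun b => ↥(A b)) fun b => (A b).subtypeₗᵢ :=
    K'.orthogonalFamily_self
  have hint : DirectSum.IsInternal A := by
    refine hOF.isInternal_iff.mpr ?_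
    rw [iSup_bool_eq]
    show (K' ⊔ K'ᗮ)ᗮ = ⊥
    rw [Submodule.sup_orthogonal_of_hasOrthogonalProjection, Submodule.top_orthogonal_eq_bot]
  have hb := hint.collectedOrthonormalBasis_mem hOF (fun i => stdOrthonormalBasis ℂ ↥(A i))
  set b := hint.collectedOrthonormalBasis hOF (fun i => stdOrthonormalBasis ℂ ↥(A i)) with hbdef
  rw [(f.restrict hV).trace_eq_sum_inner b, Complex.re_sum, Fintype.sum_sigma, Fintype.sum_bool]
  change c * _ ≤ (∑ i : Fin (Module.finrank ℂ K'),
      (⟪b ⟨true, i⟩, f.restrict hV (b ⟨true, i⟩)⟫_ℂ).re) +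
    ∑ i : Fin (Module.finrank ℂ ↥K'ᗮ), (⟪b ⟨false, i⟩, f.restrict hV (b ⟨false, i⟩)⟫_ℂ).re
  have htrue : ∀ i : Fin (Module.finrank ℂ K'),
      c ≤ (⟪b ⟨true, i⟩, f.restrict hV (b ⟨true, i⟩)⟫_ℂ).re := fun i => by
    have hmem : b ⟨true, i⟩ ∈ K' := hb ⟨true, i⟩
    have hmemK : (b ⟨true, i⟩ : E) ∈ K := (Submodule.mem_inf.mp (Submodule.mem_comap.mp hmem)).2
    have h1 : ‖b ⟨true, i⟩‖ = 1 := b.orthonormal.1 _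
    have := hK _ hmemK
    rw [Submodule.norm_coe, h1, one_pow, mul_one] at this
    rwa [Submodule.coe_inner, LinearMap.coe_restrict_apply]
  have hsum : c * (Module.finrank ℂ K' : ℝ) ≤
      ∑ i : Fin (Module.finrank ℂ K'), (⟪b ⟨true, i⟩, f.restrict hV (b ⟨true, i⟩)⟫_ℂ).re :=
    calc c * (Module.finrank ℂ K' : ℝ) = ∑ _i : Fin (Module.finrank ℂ K'), c := by
          rw [Finset.sum_const, Finset.card_univ, Fintype.card_fin, nsmul_eq_mul, mul_comm]
      _ ≤ _ := Finset.sum_le_sum fun i _ => htrue i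
  have hnonneg : 0 ≤ ∑ i : Fin (Module.finrank ℂ ↥K'ᗮ),
      (⟪b ⟨false, i⟩, f.restrict hV (b ⟨false, i⟩)⟫_ℂ).re := by
    refine Finset.sum_nonneg fun i _ => ?_
    rw [Submodule.coe_inner, LinearMap.coe_restrict_apply]
    exact h0 _
  linarith

end Trace

/-- **Registered sub-goal `stub_kyFanTraceCount`** (the output of this file, consumed by the proof of
`stub_kyFanCount`): for an endomorphism `f` of a finite-dimensional complex inner product space `E`
and a set `p` of complex numbers there is an `f`-invariant subspace `V` (namely
`⨆_{p z} maxGenEigenspace f z`) with `dim V = #{roots z of χ_f : p z}` (with multiplicity) and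
`tr f|_V = Σ_{p z} z`, such that for every subspace `K` and real `c` with `Re⟪x, f x⟫ ≥ 0` on `E`
and `≥ c‖x‖²` on `K`: `dim V + dim K ≤ dim E + dim (V ∩ K)` and `c · dim (V ∩ K) ≤ Re tr f|_V`. -/
theorem stub_kyFanTraceCount :
    ∀ (E : Type) [NormedAddCommGroup E] [InnerProductSpace ℂ E] [FiniteDimensional ℂ E]
      (f : Module.End ℂ E) (p : ℂ → Prop) [DecidablePred p], ∃ (V : Submodule ℂ E) (hV : ∀ x ∈ V,
      f x ∈ V), Module.finrank ℂ V = Multiset.card (f.charpoly.roots.filter p) ∧ LinearMap.trace ℂ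
      V (f.restrict hV) = (f.charpoly.roots.filter p).sum ∧ ∀ (K : Submodule ℂ E) (c : ℝ), (∀ x :
      E, 0 ≤ (inner ℂ x (f x)).re) → (∀ x ∈ K, c * ‖x‖ ^ 2 ≤ (inner ℂ x (f x)).re) →
      Module.finrank ℂ V + Module.finrank ℂ K ≤ Module.finrank ℂ E + Module.finrank ℂ ↥(V ⊓ K) ∧
      c * (Module.finrank ℂ ↥(V ⊓ K) : ℝ) ≤ (LinearMap.trace ℂ V (f.restrict hV)).re := by
  intro E _ _ _ f p _
  refine ⟨⨆ (z : ℂ) (_ : p z), f.maxGenEigenspace z, kyFan_mapsTo_biSup f p,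
    kyFan_finrank_biSup f p (kyFan_mapsTo_biSup f p),
    kyFan_trace_restrict f p (kyFan_mapsTo_biSup f p), fun K c h0 hK => ⟨?_, ?_⟩⟩
  · have h1 := Submodule.finrank_sup_add_finrank_inf_eq (⨆ (z : ℂ) (_ : p z), f.maxGenEigenspace z) K
    have h2 := Submodule.finrank_le ((⨆ (z : ℂ) (_ : p z), f.maxGenEigenspace z) ⊔ K)
    omega
  · exact kyFan_re_trace_restrict_ge f _ K (kyFan_mapsTo_biSup f p) h0 hK

end

end Summit.QuantumFields.QCD.Cruxes.TipPricing.CovariantLaplacianFloor
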